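import Mathlib.Data.ENat.Lattice
import Summits.BirchSwinnertonDyer.BirchSwinnertonDyer.Theorems.Rank1ResidualJetSection6
import Summits.BirchSwinnertonDyer.BirchSwinnertonDyer.Theorems.ClassRecordThreeEulerHalvesAtThreeLozenge
import HarnessLib

/-!
# [J] Prop. 6.4 abstract kernel, ADMISSIBILITY-INDEXED form: the per-(conductor, prime) hypotheses of
# `exists_halfCoreVertex` are required only for the primes `ℓ` ADMISSIBLE at `n` (`Adm n ℓ`, a predicate
# chosen by the instantiation — e.g. «`ℓ` above every prime of `c·n`»), Lemma 6.1 delivering admissible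
# primes (cell `bsd-stepL`, seat `bsd-stepL-tam3-p1`, helper toward item 19109 `EulerHalvesAtThree`,
# registered stub `stub_jetchevMaxHLAtThree`)

HONEST FRAMING. Nothing here proves BSD, J₃ or any divisibility; no item closes; 0 classes move (T7);
`--supports stmt-BirchSwinnertonDyer-19109` (helper). WHAT THIS FILE DOES. `exists_halfCoreVertex` (p484455)
asks its lozenge data `hSel`, `hSelT`, `hPT`, `hfin`, the sign flip `he` and Prop. 4.7 `h47` at EVERY pair
`(n, ℓ)` with `ℓ ∉ n`, while its proof uses them only at the prime `ℓ` delivered by Lemma 6.1 (`h61`).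
Here the same theorem is re-proved with an admissibility predicate `Adm : Finset P → P → Prop`
(`hAdm : Adm n ℓ → ℓ ∉ n`): those hypotheses are asked only for `Adm n ℓ`, and `h61` delivers `ℓ` with
`Adm n ℓ` (Čebotarev gives primes above any bound, so «`ℓ` larger than every prime used so far» is an
admissible choice of `Adm`). PURPOSE (memo MEMO-J3-v5 §4.2 (a)): with `Adm n ℓ := ℓ` above the primes of
`c·n`, the instantiation's Prop. 4.7 input `h47` is needed only along INCREASING chains of primes, where a
supplier can build the Kolyvagin–Heegner data by one-step COMPATIBLE extensions (bsd-jet's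
`JET.exists_compatible_data_of_grossCM`) and discharge `h47` from the typed McCallum Prop. 4.4
(`Koly.h47_of_prop44_of_compatData`) — removing the «coherent data system» gap. The proof is that of
p484455 verbatim with `ℓ ∉ n` replaced by `Adm n ℓ` (and `hAdm` where non-membership itself is used).
References (locators only; no cited FACT declared): [cite: Jetchev2008, Prop. 6.4 (p. 824); §3.1,
Prop. 4.7, Thm. 5.1, Lemma 5.2, Lemma 6.1] [cite: McCallumLMS1991, Cor. 3.2 (p. 299)]. Design: no
definitions; `Type*`-polymorphic. Axioms: `propext`, `Classical.choice`, `Quot.sound`.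
-/

set_option autoImplicit false

noncomputable section

open scoped Classical

namespace Summit.BirchSwinnertonDyer.Rank1Residual.JET.Section6

/-! ### §3 [J] Prop. 6.4 — abstract: HALF-core vertices exist, by the potential `#𝓗^ε · #𝓗^{−ε}` -/

section Walk

variable {G : Type*} [AddCommGroup G] {P : Type*} [DecidableEq P]
  {L : P → Type*} [∀ ℓ, AddCommGroup (L ℓ)]

/-- One step of the walk `c·n ↦ c·n·ℓ` (both signs together). Data as in `exists_halfCoreVertex`.
Given `n` with `m(cn) ≤ m(c)`, finite Selmer modules at `cn`, and `𝓗_{𝓕(cn)}^{−ε(cn)} ≠ 0`, there is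
`ℓ ∉ n` with: `m(cnℓ) ≤ m(cn)`, finite Selmer modules at `cnℓ`, and
`#𝓗_{𝓕(cnℓ)}^{ε(cnℓ)} · #𝓗_{𝓕(cnℓ)}^{−ε(cnℓ)} < #𝓗_{𝓕(cn)}^{ε(cn)} · #𝓗_{𝓕(cn)}^{−ε(cn)}`. -/
theorem halfCoreVertex_step_adm
    {p k : ℕ} (hp : p.Prime)
    (loc : ∀ ℓ : P, G →+ L ℓ) (Hf Htr : ∀ ℓ : P, Bool → AddSubgroup (L ℓ))
    (hdisj : ∀ ℓ s, Disjoint (Hf ℓ s) (Htr ℓ s))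
    (Gs : Bool → AddSubgroup G) (Sel : Finset P → Bool → AddSubgroup G)
    (Rel : Finset P → P → Bool → AddSubgroup G) (hSelGs : ∀ n s, Sel n s ≤ Gs s)
    (Adm : Finset P → P → Prop) (hAdm : ∀ n ℓ, Adm n ℓ → ℓ ∉ n)
    (hfin : ∀ n ℓ s, Adm n ℓ → Finite (Rel n ℓ s))
    (hSel : ∀ n ℓ s, Adm n ℓ → Sel n s = Rel n ℓ s ⊓ (Hf ℓ s).comap (loc ℓ))
    (hSelT : ∀ n ℓ s, Adm n ℓ → Sel (insert ℓ n) s = Rel n ℓ s ⊓ (Htr ℓ s).comap (loc ℓ))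
    (hPT : ∀ n ℓ s, Adm n ℓ → Nat.card ((Rel n ℓ s).map (loc ℓ)) = p ^ k)
    (e : Finset P → Bool) (he : ∀ n ℓ, Adm n ℓ → e (insert ℓ n) = !e n)
    (h61 : ∀ (s : Bool) (x y : G), x ∈ Gs s → y ∈ Gs (!s) → y ≠ 0 → ∀ n : Finset P,
      ∃ ℓ, Adm n ℓ ∧ addOrderOf (loc ℓ x) = addOrderOf x ∧ addOrderOf (loc ℓ y) = addOrderOf y)
    (M mdiv mc : Finset P → ℕ∞) (hm : ∀ n, mdiv n < M n → mc n ≤ mdiv n)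
    (hM : ∀ n, (k : ℕ∞) + mc ∅ ≤ M n)
    (κ κt : Finset P → G)
    (hκt : ∀ n, mc n + k ≤ M n →
      κt n ∈ Sel n (e n) ∧ addOrderOf (κt n) = p ^ k ∧ κ n = p ^ (mc n).toNat • κt n)
    (hordκ : ∀ n (j : ℕ), j < k → p ^ (k - j) ∣ addOrderOf (κ n) → mdiv n ≤ j)
    (h47 : ∀ n ℓ, Adm n ℓ → addOrderOf (loc ℓ (κ (insert ℓ n))) = addOrderOf (loc ℓ (κ n)))
    (h0 : mc ∅ < k)
    (n : Finset P) (hn : mc n ≤ mc ∅) (hfinSel : ∀ s, Finite (Sel n s))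
    (hne : Sel n (!e n) ≠ ⊥) :
    ∃ ℓ, ℓ ∉ n ∧ mc (insert ℓ n) ≤ mc n ∧ (∀ s, Finite (Sel (insert ℓ n) s)) ∧
      Nat.card (Sel (insert ℓ n) (e (insert ℓ n))) * Nat.card (Sel (insert ℓ n) (!e (insert ℓ n)))
        < Nat.card (Sel n (e n)) * Nat.card (Sel n (!e n)) := by
  -- bookkeeping in `ℕ∞`: `mc n` is finite, `< k`, and `mc n + k ≤ M n'` for every `n'`
  have hk0 : 0 < k := by
    have : (mc ∅ : ℕ∞) < k := h0
    exact Nat.pos_of_ne_zero (by rintro rfl; simp at this)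
  have hmcn_lt : mc n < (k : ℕ∞) := lt_of_le_of_lt hn h0
  have hmcn_ne : mc n ≠ ⊤ := ne_top_of_lt hmcn_lt
  set t : ℕ := (mc n).toNat with ht
  have hmct : mc n = (t : ℕ∞) := (ENat.coe_toNat hmcn_ne).symm
  have htk : t < k := by
    have : ((t : ℕ) : ℕ∞) < (k : ℕ∞) := hmct ▸ hmcn_lt
    exact_mod_cast this
  have hMn : ∀ n', mc n + k ≤ M n' := fun n' =>
    calc mc n + (k : ℕ∞) ≤ mc ∅ + k := add_le_add hn le_rfl
      _ = (k : ℕ∞) + mc ∅ := add_comm _ _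
      _ ≤ M n' := hM n'
  -- the class `κ̃` at `cn`
  obtain ⟨hκtSel, hκtord, hκeq⟩ := hκt n (hMn n)
  -- a non-zero class on the `−ε(cn)` side
  obtain ⟨y, hySel, hy0⟩ : ∃ y ∈ Sel n (!e n), y ≠ 0 := by
    rcases (Sel n (!e n)).bot_or_exists_ne_zero with h | ⟨y, hy, hy0⟩
    · exact (hne h).elim
    · exact ⟨y, hy, hy0⟩
  -- Lemma 6.1: choose `ℓ ∉ n`
  obtain ⟨ℓ, hℓn, hℓx, hℓy⟩ :=
    h61 (e n) (κt n) y (hSelGs _ _ hκtSel) (hSelGs _ _ hySel) hy0 n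
  rw [hκtord] at hℓx
  haveI : ∀ s, Finite (Rel n ℓ s) := fun s => hfin n ℓ s hℓn
  haveI : ∀ s, Finite ((Rel n ℓ s).map (loc ℓ)) := fun s => finite_map_of_finite (loc ℓ) _
  -- ε-side: `Sel n (e n) = Rel`, `Sel n⁺ (e n) = Rel ⊓ ker`, `#Sel n (e n) = #Sel n⁺ (e n) · p^k`
  have hxRel : κt n ∈ Rel n ℓ (e n) := by
    have := hκtSel; rw [hSel n ℓ (e n) hℓn] at this; exact this.1
  have hxf : loc ℓ (κt n) ∈ Hf ℓ (e n) := by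
    have := hκtSel; rw [hSel n ℓ (e n) hℓn] at this; exact this.2
  obtain ⟨hA1, hA2, hA3⟩ := lozenge_epsSide (loc ℓ) (Rel n ℓ (e n)) (Hf ℓ (e n)) (Htr ℓ (e n))
    (hdisj ℓ (e n)) hxRel hxf (by rw [hPT n ℓ (e n) hℓn, hℓx])
  have hSel_e : Sel n (e n) = Rel n ℓ (e n) := by rw [hSel n ℓ (e n) hℓn, hA1]
  have hSelT_e : Sel (insert ℓ n) (e n) = Rel n ℓ (e n) ⊓ (loc ℓ).ker := by
    rw [hSelT n ℓ (e n) hℓn, hA2]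
  have hcard_e : Nat.card (Sel n (e n)) = Nat.card (Sel (insert ℓ n) (e n)) * p ^ k := by
    rw [hSel_e, hSelT_e, hA3, hℓx]
  -- −ε-side: `#Sel n⁺ (!e n) · ord(y)² ≤ p^k · #Sel n (!e n)`
  have hyRel : y ∈ Rel n ℓ (!e n) := by
    have := hySel; rw [hSel n ℓ (!e n) hℓn] at this; exact this.1
  have hyf : loc ℓ y ∈ Hf ℓ (!e n) := by
    have := hySel; rw [hSel n ℓ (!e n) hℓn] at this; exact this.2
  have hB := lozenge_negSide (loc ℓ) (Rel n ℓ (!e n)) (Hf ℓ (!e n)) (Htr ℓ (!e n))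
    (hdisj ℓ (!e n)) hyRel hyf
  rw [hPT n ℓ (!e n) hℓn, hℓy, ← hSel n ℓ (!e n) hℓn, ← hSelT n ℓ (!e n) hℓn] at hB
  -- `ord y ≥ 2`
  have hordy : 2 ≤ addOrderOf y := by
    haveI := hfinSel (!e n)
    have hdvd : addOrderOf y ∣ Nat.card (Sel n (!e n)) :=
      (Sel n (!e n)).addOrderOf_dvd_natCard hySel
    have hcpos : 0 < Nat.card (Sel n (!e n)) := Nat.card_pos
    have hpos : 0 < addOrderOf y := Nat.pos_of_dvd_of_pos hdvd hcpos
    have hne1 : addOrderOf y ≠ 1 := by rwa [Ne, AddMonoid.addOrderOf_eq_one_iff]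
    omega
  -- finiteness at `n⁺`
  have hfinT : ∀ s, Finite (Sel (insert ℓ n) s) := by
    intro s; rw [hSelT n ℓ s hℓn]; exact finite_of_le' inf_le_left
  -- `m(cnℓ) ≤ m(cn)` (Prop. 4.7 + §3.1 bookkeeping)
  have hmc : mc (insert ℓ n) ≤ mc n := by
    have hordκn : addOrderOf (loc ℓ (κ n)) = p ^ (k - t) := by
      rw [hκeq, map_nsmul]
      exact addOrderOf_pow_nsmul_eq hp htk.le _ hℓx
    have hdvd : p ^ (k - t) ∣ addOrderOf (κ (insert ℓ n)) := by
      rw [← hordκn, ← h47 n ℓ hℓn]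
      exact addOrderOf_map_dvd (loc ℓ) _
    have h1 : mdiv (insert ℓ n) ≤ (t : ℕ∞) := hordκ _ t htk hdvd
    have h2 : mdiv (insert ℓ n) < M (insert ℓ n) := by
      calc mdiv (insert ℓ n) ≤ (t : ℕ∞) := h1
        _ = mc n := hmct.symm
        _ < mc n + k := by
            rw [hmct]
            exact_mod_cast Nat.lt_add_of_pos_right hk0
        _ ≤ M (insert ℓ n) := hMn _
    calc mc (insert ℓ n) ≤ mdiv (insert ℓ n) := hm _ h2
      _ ≤ (t : ℕ∞) := h1
      _ = mc n := hmct.symm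
  -- the potential drops
  refine ⟨ℓ, hAdm n ℓ hℓn, hmc, hfinT, ?_⟩
  have he' : e (insert ℓ n) = !e n := he n ℓ hℓn
  rw [he', Bool.not_not, hcard_e]
  haveI := hfinT (e n)
  haveI := hfinT (!e n)
  have hpos1 : 0 < Nat.card (Sel (insert ℓ n) (e n)) := Nat.card_pos
  have hpos2 : 0 < Nat.card (Sel (insert ℓ n) (!e n)) := Nat.card_pos
  -- `#T(!e) * ord(y)^2 ≤ p^k * #Sel n (!e n)` with `ord y ≥ 2`
  have h4 : Nat.card (Sel (insert ℓ n) (!e n)) * 4 ≤ p ^ k * Nat.card (Sel n (!e n)) :=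
    le_trans (Nat.mul_le_mul_left _ (by nlinarith [hordy])) hB
  nlinarith [h4, hpos1, hpos2]

/-- **Jetchev 2008, Prop. 6.4 (p. 824), abstract kernel form — HALF-core vertices exist.**
Fix a level `p^k`, a conductor `c` with `m(c) < k` and `m(c) + k ≤ M(c·n)` for every square-free
product `n` of the available Kolyvagin primes `P` (those `ℓ ∈ Λ¹` prime to `c` with `M(ℓ) ≥ k + m(c)`).
DATA (dictionary, [J] §§3.1, 4.3, 5, 6): `G ↦ H¹(K, E[p^k])`, `Gs s ↦` its `±`-eigenspaces under
complex conjugation; `loc ℓ ↦ loc_λ`, `Hf ℓ s`, `Htr ℓ s ↦` the `s`-parts of the finite and the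
transverse conditions at `λ ∣ ℓ` (disjoint); `Sel n s ↦ 𝓗_{𝓕(cn)}^s`, `Rel n ℓ s ↦ 𝓗_{𝓕^ℓ(cn)}^s`
(finite), related by `hSel`/`hSelT` (the structures `𝓕(cn)`, `𝓕(cnℓ)` are `𝓕^ℓ(cn)` plus the finite,
resp. transverse, condition at `λ`); `hPT ↦ #loc_λ(𝓗_{𝓕^ℓ(cn)}^s) = p^k` = Thm. 5.1 for
`𝓕_ℓ(cn) ≼ 𝓕^ℓ(cn)` with the self-duality of the Kummer structure (Lemma 5.2 (iii), `a + a^* = m`, per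
sign); `e n ↦ ε(cn)` with `ε(cnℓ) = −ε(cn)` (§3.1 item 6); `h61 ↦` Lemma 6.1 (= McCallum 1991 Cor. 3.2:
infinitely many `ℓ`, so `ℓ ∉ n` may be imposed); `M n ↦ M(cn)`, `mdiv n ↦ m'(cn)`, `mc n ↦ m(cn)` with
`hm ↦` §3.1 item 5 (in the convention-insensitive form of `depth_le_mdiv_of_le_mInfty`), `hM ↦` the
choice of `P`; `κ n ↦ κ_{cn,k}`, `κt n ↦ κ̃_{cn,k}` with `hκt ↦` §3.1 item 7 (`κ̃` defined when
`m(cn) + k ≤ M(cn)`, of order `p^k`, `κ = p^{m(cn)} κ̃`, on the `ε(cn)` side) and `hordκ ↦` §3.1 items 4–5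
with the injectivity of `E(K[cn])/p^k → H¹` (`ord κ_{cn,k} = p^{k − m'(cn)}` when `m'(cn) ≤ k`, else
`κ_{cn,k} = 0`); `h47 ↦` Prop. 4.7 (`loc_λ κ_{cnℓ} = φ_λ(loc_λ κ_{cn})`, `φ_λ` an isomorphism).
CONCLUSION: some `c' = c·n` has `𝓗_{𝓕(c')}^{−ε(c')} = 0` and `m(c') ≤ m(c)` (whence
`m(c') + k ≤ M(c')` and `κ̃_{c',k}` of order `p^k` on the `ε(c')` side: the hypotheses `hcore`, `hκt`
of `tamagawaExponent_le_mInfty_of_minimalCoreVertex`, which never uses `𝓗^{ε(c')} ≅ ℤ/p^k`).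
PROOF (NOT the printed invariant-lowering sketch, whose «`y₁ = y₂`» needs the Cassels–Tate∕Flach pair
structure): as long as `𝓗_{𝓕(cn)}^{−ε} ≠ 0` pick `y ≠ 0` in it and `ℓ` by Lemma 6.1 for
`(κ̃_{cn}, y)`; by `lozenge_epsSide` ∕ `lozenge_negSide` the potential `#𝓗_{𝓕(cn)}^{ε}·#𝓗_{𝓕(cn)}^{−ε}`
drops at `cnℓ` by the factor `ord(y)² ≥ 4`, and `m(cnℓ) ≤ m(cn)` by Prop. 4.7; induction on the
potential. [cite: Jetchev2008, Prop. 6.4 (p. 824); §3.1, Prop. 4.7, Thm. 5.1, Lemma 5.2, Lemma 6.1]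
[cite: McCallumLMS1991, Cor. 3.2 (p. 299)] -/
theorem exists_halfCoreVertex_adm
    {p k : ℕ} (hp : p.Prime)
    (loc : ∀ ℓ : P, G →+ L ℓ) (Hf Htr : ∀ ℓ : P, Bool → AddSubgroup (L ℓ))
    (hdisj : ∀ ℓ s, Disjoint (Hf ℓ s) (Htr ℓ s))
    (Gs : Bool → AddSubgroup G) (Sel : Finset P → Bool → AddSubgroup G)
    (Rel : Finset P → P → Bool → AddSubgroup G) (hSelGs : ∀ n s, Sel n s ≤ Gs s)
    (Adm : Finset P → P → Prop) (hAdm : ∀ n ℓ, Adm n ℓ → ℓ ∉ n)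
    (hfin : ∀ n ℓ s, Adm n ℓ → Finite (Rel n ℓ s))
    (hSel : ∀ n ℓ s, Adm n ℓ → Sel n s = Rel n ℓ s ⊓ (Hf ℓ s).comap (loc ℓ))
    (hSelT : ∀ n ℓ s, Adm n ℓ → Sel (insert ℓ n) s = Rel n ℓ s ⊓ (Htr ℓ s).comap (loc ℓ))
    (hPT : ∀ n ℓ s, Adm n ℓ → Nat.card ((Rel n ℓ s).map (loc ℓ)) = p ^ k)
    (e : Finset P → Bool) (he : ∀ n ℓ, Adm n ℓ → e (insert ℓ n) = !e n)
    (h61 : ∀ (s : Bool) (x y : G), x ∈ Gs s → y ∈ Gs (!s) → y ≠ 0 → ∀ n : Finset P,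
      ∃ ℓ, Adm n ℓ ∧ addOrderOf (loc ℓ x) = addOrderOf x ∧ addOrderOf (loc ℓ y) = addOrderOf y)
    (M mdiv mc : Finset P → ℕ∞) (hm : ∀ n, mdiv n < M n → mc n ≤ mdiv n)
    (hM : ∀ n, (k : ℕ∞) + mc ∅ ≤ M n)
    (κ κt : Finset P → G)
    (hκt : ∀ n, mc n + k ≤ M n →
      κt n ∈ Sel n (e n) ∧ addOrderOf (κt n) = p ^ k ∧ κ n = p ^ (mc n).toNat • κt n)
    (hordκ : ∀ n (j : ℕ), j < k → p ^ (k - j) ∣ addOrderOf (κ n) → mdiv n ≤ j)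
    (h47 : ∀ n ℓ, Adm n ℓ → addOrderOf (loc ℓ (κ (insert ℓ n))) = addOrderOf (loc ℓ (κ n)))
    (h0 : mc ∅ < k) :
    ∃ n : Finset P, Sel n (!e n) = ⊥ ∧ mc n ≤ mc ∅ := by
  -- the inductive claim, on the potential, for conductors with finite Selmer modules
  have claim : ∀ (N : ℕ) (n : Finset P), mc n ≤ mc ∅ → (∀ s, Finite (Sel n s)) →
      Nat.card (Sel n (e n)) * Nat.card (Sel n (!e n)) ≤ N →
      ∃ n' : Finset P, Sel n' (!e n') = ⊥ ∧ mc n' ≤ mc ∅ := by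
    intro N
    induction N with
    | zero =>
      intro n _ hfinSel hΦ
      haveI := hfinSel (e n); haveI := hfinSel (!e n)
      have h1 : 0 < Nat.card (Sel n (e n)) := Nat.card_pos
      have h2 : 0 < Nat.card (Sel n (!e n)) := Nat.card_pos
      have : 0 < Nat.card (Sel n (e n)) * Nat.card (Sel n (!e n)) := Nat.mul_pos h1 h2
      omega
    | succ N ih =>
      intro n hn hfinSel hΦ
      by_cases hcore : Sel n (!e n) = ⊥
      · exact ⟨n, hcore, hn⟩
      obtain ⟨ℓ, -, hmc, hfinT, hlt⟩ := halfCoreVertex_step_adm hp loc Hf Htr hdisj Gs Sel Rel hSelGs Adm hAdm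
        hfin hSel hSelT hPT e he h61 M mdiv mc hm hM κ κt hκt hordκ h47 h0 n hn hfinSel hcore
      exact ih (insert ℓ n) (hmc.trans hn) hfinT (by omega)
  -- start of the walk: either `c` itself is a half-core vertex, or one step makes everything finite
  by_cases hcore : Sel ∅ (!e ∅) = ⊥
  · exact ⟨∅, hcore, le_rfl⟩
  -- a non-zero `y` and Lemma 6.1 give some `ℓ`, whence finiteness of the Selmer modules at `c`
  obtain ⟨y, hySel, hy0⟩ : ∃ y ∈ Sel ∅ (!e ∅), y ≠ 0 := by
    rcases (Sel ∅ (!e ∅)).bot_or_exists_ne_zero with h | ⟨y, hy, hy0⟩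
    · exact (hcore h).elim
    · exact ⟨y, hy, hy0⟩
  have hM0 : mc ∅ + k ≤ M ∅ := by rw [add_comm]; exact hM ∅
  obtain ⟨hκtSel, -, -⟩ := hκt ∅ hM0
  obtain ⟨ℓ, hℓn, -, -⟩ := h61 (e ∅) (κt ∅) y (hSelGs _ _ hκtSel) (hSelGs _ _ hySel) hy0 ∅
  have hfin0 : ∀ s, Finite (Sel ∅ s) := by
    intro s
    haveI := hfin ∅ ℓ s hℓn
    rw [hSel ∅ ℓ s hℓn]
    exact finite_of_le' inf_le_left
  exact claim _ ∅ le_rfl hfin0 le_rfl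

end Walk

end Summit.BirchSwinnertonDyer.Rank1Residual.JET.Section6

end
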